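import Literature.MathematicalPhysics.QuantumFieldTheory.Balaban1983to89.T3Thm1Carrier
import HarnessLib

/-!
# `Balaban1983to89.T3Thm1UniquenessSchema` — [Balaban1985Variational] THEOREM 1's UNIQUENESS CLAUSE («unique critical orbit in (6)») and
# PROPOSITION 7's CLAUSE 1 («at most one critical orbit») for the pure small-field variational problems of the T³ family, as `L`-level
# hypothesis schemas AT GIVEN CONSTANTS — the siblings of `T3PrintedMinimiserExistence.Thm1GlobalMinAt` ∕ `Thm1MinimalIn8At` (existence) — with
# the edges from LQB's statements AS PRINTED (`B11Thm1.Thm1At`, `B11.Prop7Printed`) at the carriers `T3Thm1Carrier.varProblem3`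

Cell `ym3-torus` (HUMAN RULING D-0037, YM ladder rung R3), seat `ym3-torus-px20` gen 14 (UV side, (α)-row #23 of the CMP 102 gap list).  WHY.  The lower bound
(47)∕(57) of [Balaban1985UV3] at print's `χ_k` (window constant `c = 1`) reads the GAUGE INVARIANCE of the family `{V | |U_k(V)(∂p) − 1| < g_kp(g_k)η²}`, i.e. the
ORBIT COVARIANCE `U_k(V^u) ∈ orbit(U_k(V))` of Bałaban's background field ([Balaban1985Variational] (181) p.307; [Balaban1987RG1] (0.21) p.256 «a unique critical
orbit, which is a set of minima … We denote a configuration in this orbit by U_k(V)»).  For an arbitrary SELECTION of minimisers this follows from the existence clause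
(8) together with the UNIQUENESS clause of Thm 1 — «This orbit is a unique critical orbit in the space (6) if B₃ε₁ ≤ ε₀ and ε₀ ≤ a₀» (p.279, second sentence) —
equivalently from Prop. 7's clause 1 p.299 «for ε₀ ≤ a₀ and B₃ε₁ ≤ ε₀ the variational problem (5), (6) has at most one critical orbit».  The existence clause has its
`L`-level schemas (`Thm1GlobalMinAt`, `Thm1MinimalIn8At`); this file supplies the uniqueness schemas in the SAME shape (quantifier prefix of `Thm1GlobalMinAt` token for
token), so that a route row can name them next to `Thm1GlobalMinAt L a₀ a₁ B₃`.

CONTENTS (hypothesis schemas and bookkeeping; nothing of [Balaban1985Variational] is asserted):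
* §1 `Thm1UniqueMinOrbitAt L a₀ a₁ B₃` — Thm 1 sentence 2 at given constants, MINIMISER reading (reading R2 of `T3Thm1Carrier`: «critical in (6)(ε₀)» ↦ «minimises (5)
  over (6)(ε₀)»; a minimiser over the open set (6) is critical by Fermat, so the reading is implied by print): for every member `F` (`F.L = L`), `n < K`, `0 < ε₁ ≤ a₁`,
  `B₃ε₁ ≤ ε₀ ≤ a₀`, every (7)-datum `V` and every `U` on a minimal orbit of (5) in (8), every minimiser of (5) over (6)(ε₀) lies on the orbit of `U` under the group (4)
  (`T3Thm1Carrier.SameOrbit`: `u↓ = 1`) — in the carrier's fields, `OnMinimalOrbit (B₃ε₁) V U → UniqueCriticalOrbit ε₀ V U`;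
  `Prop7AtMostOneCriticalOrbitAt L a₀ B₃` — Prop. 7 clause 1 at given constants (`VarProblemX.AtMostOneCriticalOrbit` at the carriers); `Iff.rfl` unfoldings.
  (Statement-only file.  The EDGES — the schema ⇐ `B11Thm1.Thm1At` over `fam L` (two tokens, sibling of `T3Thm1Carrier.thm1MinimalIn8At_of_thm1At`), ⇐ Prop. 7 clause 1
  ((8) ⊆ (6) + reading-R2 criticality), `Prop7AtMostOneCriticalOrbitAt` ⇐ `B11.Prop7Printed … (famX L)`, the dictionary with `B11Thm1.Unique6`, monotonicity in the
  constants — and the consumer at the (α)-row #23 record live Summits-side in `Summits/QuantumFields/YangMills/Theorems/AlphaInputsT3ACv3StepLowPrintOrbitOfThm1Unique.lean`.)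
WHAT THIS IS NOT: no proof of uniqueness (print: Sect. E, the contraction (142)ff. for (111)); the schemas are never asserted.

References: T. Bałaban, Commun. Math. Phys. 102 (1985) 277–309 [Balaban1985Variational] ((4)–(8) p.278, Thm 1 p.279, Prop. 7 p.299, (181) p.307); Commun. Math. Phys. 102
(1985) 255–275 [Balaban1985UV3] ((47) p.267); Commun. Math. Phys. 109 (1987) 249–301 [Balaban1987RG1] ((0.21) p.256).
-/


noncomputable section

open Literature.MathematicalPhysics.QuantumFieldTheory.Balaban1983to89.T3ContinuumYM3Torus
open Literature.MathematicalPhysics.QuantumFieldTheory.Balaban1983to89.T3Thm1Carrier (varProblem3)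

namespace Literature.MathematicalPhysics.QuantumFieldTheory.Balaban1983to89.T3Thm1UniquenessSchema

/-! ## §1 The schemas -/

section Schema

/-- **[Balaban1985Variational] THM 1, UNIQUENESS CLAUSE, AT GIVEN CONSTANTS** (hypothesis schema, never asserted; MINIMISER reading R2): for every member `F` of the d = 3
family with block size `L` (pure small field: every `Ω_j` the torus), every `n < K`, every `0 < ε₁ ≤ a₁` and `B₃ε₁ ≤ ε₀ ≤ a₀` (the quantifier prefix of
`T3PrintedMinimiserExistence.Thm1GlobalMinAt` token for token), every datum `V` with (7) `|V(∂p) − 1| < ε₁`, and every configuration `U` on a minimal orbit of the Wilson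
action (5) in the space (8) = `regFibrePr F n K _ (B₃ε₁) V`: every minimiser of (5) over the space (6) = `regFibrePr F n K _ ε₀ V` lies on the orbit of `U` under print's group (4)
(`SameOrbit`, `u↓ = 1`) — Thm 1 p.279 «there exists a minimal orbit in the space 𝔘_k({Ω_j}, B₃ε₁) ∩ 𝔅_k(V) (8). This orbit is a unique critical orbit in the space (6) if
B₃ε₁ ≤ ε₀ and ε₀ ≤ a₀», second sentence, read with «critical» ↦ «minimising over (6)» (weaker than print: a minimiser over the open set (6) is critical).  In the fields of the
carrier `T3Thm1Carrier.varProblem3 F n K`: `OnMinimalOrbit (B₃ε₁) V U → UniqueCriticalOrbit ε₀ V U` (= the body of `B11Thm1.Unique6`). [cite: Balaban1985Variational, Thm 1 (8) p.279] -/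
def Thm1UniqueMinOrbitAt (L : ℕ) (a₀ a₁ B₃ : ℝ) : Prop :=
  ∀ F : T3Family, F.L = L → ∀ (n K : ℕ) (hnK : n < K) (ε₁ ε₀ : ℝ), 0 < ε₁ → ε₁ ≤ a₁ → B₃ * ε₁ ≤ ε₀ → ε₀ ≤ a₀ →
    ∀ V : GaugeField (F.P n) 0 (Matrix.specialUnitaryGroup (Fin 2) ℂ), PlaqSmall ε₁ V →
      ∀ U : GaugeField (F.P K) 0 (Matrix.specialUnitaryGroup (Fin 2) ℂ),
        (varProblem3 F n K hnK.le).OnMinimalOrbit (B₃ * ε₁) V U → (varProblem3 F n K hnK.le).UniqueCriticalOrbit ε₀ V U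

/-- **[Balaban1985Variational] PROP. 7, CLAUSE 1, AT GIVEN CONSTANTS** (hypothesis schema, never asserted): «There exist positive, absolute constants a₀, a′₁ such that for
ε₀ ≤ a₀ and B₃ε₁ ≤ ε₀ the variational problem (5), (6) has at most one critical orbit» — for every member with block size `L`, every `n < K`, `0 < ε₁`, `B₃ε₁ ≤ ε₀ ≤ a₀` and
every (7)-datum `V`: any two configurations of (6)(ε₀) critical in reading R2 lie on one orbit of the group (4) (`VarProblemX.AtMostOneCriticalOrbit` at the carrier = clause 1
of LQB's `B11.Prop7Printed` with the constant outside). [cite: Balaban1985Variational, Prop. 7 p.299] -/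
def Prop7AtMostOneCriticalOrbitAt (L : ℕ) (a₀ B₃ : ℝ) : Prop :=
  ∀ F : T3Family, F.L = L → ∀ (n K : ℕ) (hnK : n < K) (ε₁ ε₀ : ℝ), 0 < ε₁ → B₃ * ε₁ ≤ ε₀ → ε₀ ≤ a₀ →
    ∀ V : GaugeField (F.P n) 0 (Matrix.specialUnitaryGroup (Fin 2) ℂ), PlaqSmall ε₁ V → (varProblem3 F n K hnK.le).AtMostOneCriticalOrbit ε₀ V

variable {L : ℕ} {a₀ a₁ B₃ : ℝ}

/-- Unfolding (`Iff.rfl`). [cite: Balaban1985Variational, Thm 1 (8) p.279] -/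
theorem thm1UniqueMinOrbitAt_iff : Thm1UniqueMinOrbitAt L a₀ a₁ B₃ ↔
    ∀ F : T3Family, F.L = L → ∀ (n K : ℕ) (hnK : n < K) (ε₁ ε₀ : ℝ), 0 < ε₁ → ε₁ ≤ a₁ → B₃ * ε₁ ≤ ε₀ → ε₀ ≤ a₀ →
      ∀ V : GaugeField (F.P n) 0 (Matrix.specialUnitaryGroup (Fin 2) ℂ), PlaqSmall ε₁ V →
        ∀ U : GaugeField (F.P K) 0 (Matrix.specialUnitaryGroup (Fin 2) ℂ),
          (varProblem3 F n K hnK.le).OnMinimalOrbit (B₃ * ε₁) V U → (varProblem3 F n K hnK.le).UniqueCriticalOrbit ε₀ V U :=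
  Iff.rfl

/-- Unfolding (`Iff.rfl`). [cite: Balaban1985Variational, Prop. 7 p.299] -/
theorem prop7AtMostOneCriticalOrbitAt_iff : Prop7AtMostOneCriticalOrbitAt L a₀ B₃ ↔
    ∀ F : T3Family, F.L = L → ∀ (n K : ℕ) (hnK : n < K) (ε₁ ε₀ : ℝ), 0 < ε₁ → B₃ * ε₁ ≤ ε₀ → ε₀ ≤ a₀ →
      ∀ V : GaugeField (F.P n) 0 (Matrix.specialUnitaryGroup (Fin 2) ℂ), PlaqSmall ε₁ V → (varProblem3 F n K hnK.le).AtMostOneCriticalOrbit ε₀ V :=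
  Iff.rfl

end Schema

end Literature.MathematicalPhysics.QuantumFieldTheory.Balaban1983to89.T3Thm1UniquenessSchema

end
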